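import Summits.BirchSwinnertonDyer.BirchSwinnertonDyer.Theorems.BiquadraticEisensteinDescentHeegnerTwistCouplingInSupplySymbolicMonskyEvenDesignCore
import Summits.BirchSwinnertonDyer.BirchSwinnertonDyer.Theorems.BiquadraticEisensteinDescentHeegnerTwistCouplingInSupplySymbolicMonskyClosureSemantic
import HarnessLib

set_option linter.dupNamespace false -- `Summit.BirchSwinnertonDyer.BirchSwinnertonDyer.Theorems.…` (summit = sub)
set_option autoImplicit false

/-!
# Crux `HeegnerTwistCouplingInSupply` (stmt-BirchSwinnertonDyer-21381) — ★★ THE EVEN DESIGN CRITERION: any number of free cells, EVEN bases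
# `E_{2·P₀⋯P_k}`, every mutual pattern

Route `BiquadraticEisensteinDescent` (cell `pub/bsd-wall`, width seat `bsd-wall-cm-bed-w3` g23; `--supports` 21381, helper). The even twin of
`…SymbolicMonskyDesign` (p741990, odd bases). For a base datum `base : SymbData (k+1)` (primes `P₀ … P_k`; the base is `n₀ = 2·P₀⋯P_k`) and the
design `c₁ :: rest` (free cells with symbol vectors `σ_i` and `(2/·)`-classes `d'_i`; `c₁ ≡ 3 (4)` Heegner-forced), with `c_i = |σ_i|`:
(span) the pairs `(⟨σ_i, λ⟩ + ⟨m,μ⟩(c_i + d'_i), ⟨σ_i, μ⟩)` over the even left pairs `(λ, μ)` together with `(d'_i, c_i + d'_i)` have only `0` as a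
common orthogonal; (inj) the only `(u, v, U₀, V₀)` with `(u,v)` an even kernel pair, `V₀ = ⟨m,u⟩`, `⟨σ_i, u⟩ + (c_i + d'_i)U₀ = 0`,
`⟨σ_i, v⟩ + c_i V₀ + d'_i (U₀ + V₀) = 0` is zero. THEN (`det_dataK_even_design_eq_one`, semantic closure criterion
`SymbData.det_monskyEvenS_eq_one_of_staged_constancy` with the directions `u`, `v`) Monsky's EVEN matrix of `(base, c₁ :: rest, pat)` is
invertible for EVERY mutual pattern, and (`even_design_recipe`) the design passes the Heegner check: a PATTERN-FREE HEEGNER RECIPE for the even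
base with `τ + 1` auxiliary primes. In the memo's language (THEOREM-A-w3g22 §6b, verified there 2500/2500 for `K ≤ 6`): the even pencil
`W_ev = {(λ + ⟨μ,m⟩(1+δ), μ)} ⊕ ⟨(δ, 1+δ)⟩` is mapped bijectively by `ρ`; by the duality of `…EvenDesignCore` (span) and (inj) live on the same
space, so the EVEN THEOREM A (existence at `t₀^{ev}` from the transversality theorem p740643) is the successor's one-file step.

HONEST FRAMING: linear algebra over `𝔽₂`; RUNG-LEVEL corner layer (even congruent `j = 1728` families); instances still need located primes
(`RealisesK.cruxOn_even_of_BT_of_forall`) and the print input (Burungale–Tian); the crux as stated (C⁺), its registered stubs and BSD are NOT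
touched; nothing is closed. THEOREMS ONLY. Reference: [HeathBrown1994] appendix (Monsky), typescript p. 41 L20–L36.
-/

namespace Summit.BirchSwinnertonDyer.BirchSwinnertonDyer.Theorems.SymbolicMonsky

section EvenDesignRecipe

open Matrix

variable {k : ℕ} (base : SymbData (k + 1)) (c₁ : AuxCell) (rest : List AuxCell)

/-- ★★ **THE EVEN DESIGN CRITERION**: under (span) for the even left pairs and (inj) `hF`, Monsky's EVEN matrix of
`(base, c₁ :: rest, pat)` — the base `E_{2·P₀⋯P_k}` — has `det = 1` for EVERY mutual pattern `pat`.
[cite: HeathBrown1994SelmerCongruentII, Appendix (Monsky), typescript p. 41 L20–L36] -/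
theorem det_dataK_even_design_eq_one (hm1 : negNegOne c₁.1 = true)
    (hmr : ∀ i : Fin rest.length, negNegOne (rest.getD i.val (0, 0)).1 = false)
    (σ : Fin rest.length → Fin (k + 1) → ZMod 2) (hσ : ∀ i b, bz ((rest.getD i.val (0, 0)).2.testBit b.val) = σ i b)
    (hσ1 : ∀ b : Fin (k + 1), bz (c₁.2.testBit b.val) = bz (negNegOne (base.cls b)) + ∑ i, σ i b)
    (dp : Fin rest.length → ZMod 2) (hdp : ∀ i, bz (negTwo (rest.getD i.val (0, 0)).1) = dp i)
    (hd1 : bz (negTwo c₁.1) = ∑ i, dp i)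
    (hspan : ∀ a e : Fin rest.length → ZMod 2,
      (∀ lam mu : Fin (k + 1) → ZMod 2,
        (∀ b, (∑ b', bz (base.neg b b') * (lam b' + lam b)) + bz (negNegOne (base.cls b)) * lam b +
          bz (negTwo (base.cls b)) * lam b + bz (negTwo (base.cls b)) * mu b +
          bz (negNegOne (base.cls b)) * (∑ b', bz (negNegOne (base.cls b')) * mu b') = 0) →
        (∀ b, bz (negNegOne (base.cls b)) * lam b + (∑ b', bz (base.neg b b') * (mu b' + mu b)) +
          bz (negNegOne (base.cls b)) * (∑ b', bz (negNegOne (base.cls b')) * mu b') + bz (negTwo (base.cls b)) * mu b = 0) →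
        (∑ i, (a i * ((∑ b, σ i b * lam b) + (∑ b, bz (negNegOne (base.cls b)) * mu b) * ((∑ b, σ i b) + dp i)) +
          e i * (∑ b, σ i b * mu b))) = 0) →
      (∑ i, (dp i * a i + ((∑ b, σ i b) + dp i) * e i)) = 0 → (∀ i, a i = 0) ∧ (∀ i, e i = 0))
    (hF : ∀ (u v : Fin (k + 1) → ZMod 2) (U0 V0 : ZMod 2),
      (∀ b, (∑ b', bz (base.neg b b') * (u b' + u b)) +
        bz (negNegOne (base.cls b)) * (∑ b', bz (negNegOne (base.cls b')) * u b') +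
        bz (negTwo (base.cls b)) * u b + bz (negNegOne (base.cls b)) * v b = 0) →
      (∀ b, bz (negTwo (base.cls b)) * u b + (∑ b', bz (base.neg b b') * (v b' + v b)) +
        bz (negNegOne (base.cls b)) * v b + bz (negTwo (base.cls b)) * v b + bz (negNegOne (base.cls b)) * V0 = 0) →
      V0 = (∑ b', bz (negNegOne (base.cls b')) * u b') →
      (∀ i, (∑ b, σ i b * u b) + ((∑ b, σ i b) + dp i) * U0 = 0) →
      (∀ i, (∑ b, σ i b * v b) + (∑ b, σ i b) * V0 + dp i * (U0 + V0) = 0) →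
      u = 0 ∧ v = 0 ∧ U0 = 0 ∧ V0 = 0)
    (pat : ℕ → ℕ → Bool) : (dataK base (c₁ :: rest) pat).monskyEvenS.det = 1 := by
  classical
  have h10 : ((1 : ℕ) = 0) = False := by simp
  have auxIdx : ∀ i : Fin (k + 1 + (c₁ :: rest).length), auxQ k (c₁ :: rest).length i = true →
      ∃ j : Fin (c₁ :: rest).length, i = Fin.natAdd (k + 1) j := by
    intro i hi
    induction i using Fin.addCases with
    | left b => rw [auxQ_castAdd] at hi; exact absurd hi (by simp)
    | right j => exact ⟨j, rfl⟩
  have CORE : ∀ z : Fin (k + 1 + (c₁ :: rest).length) ⊕ Fin (k + 1 + (c₁ :: rest).length) → ZMod 2,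
      (∀ i, auxQ k (c₁ :: rest).length i = false →
        ((dataK base (c₁ :: rest) (fun _ _ => false)).monskyEvenS *ᵥ z) (Sum.inl i) = 0 ∧
        ((dataK base (c₁ :: rest) (fun _ _ => false)).monskyEvenS *ᵥ z) (Sum.inr i) = 0) →
      (∑ i ∈ Finset.univ.filter (fun i => auxQ k (c₁ :: rest).length i = true),
        ((dataK base (c₁ :: rest) (fun _ _ => false)).monskyEvenS *ᵥ z) (Sum.inl i)) = 0 →
      (∑ i ∈ Finset.univ.filter (fun i => auxQ k (c₁ :: rest).length i = true),
        ((dataK base (c₁ :: rest) (fun _ _ => false)).monskyEvenS *ᵥ z) (Sum.inr i)) = 0 →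
      ∀ j j' : Fin (c₁ :: rest).length,
        z (Sum.inl (Fin.natAdd (k + 1) j)) = z (Sum.inl (Fin.natAdd (k + 1) j')) ∧
        z (Sum.inr (Fin.natAdd (k + 1) j)) = z (Sum.inr (Fin.natAdd (k + 1) j')) := by
    intro z hout hs1 hs2
    rw [sum_filter_auxQ] at hs1 hs2
    have huv := even_design_core base c₁ rest hm1 hmr σ hσ hσ1 dp hdp hd1 hspan z
      (fun b => (hout _ (auxQ_castAdd _ b)).1) (fun b => (hout _ (auxQ_castAdd _ b)).2) hs1 hs2
    have hu0 : ∀ j : Fin (c₁ :: rest).length, z (Sum.inl (Fin.natAdd (k + 1) j)) =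
        z (Sum.inl (Fin.natAdd (k + 1) (⟨0, by simp⟩ : Fin (c₁ :: rest).length))) := by
      intro j
      rcases fin_cons_cases c₁ rest j with rfl | ⟨i, rfl⟩
      · rfl
      · exact (huv i).1
    have hv0 : ∀ j : Fin (c₁ :: rest).length, z (Sum.inr (Fin.natAdd (k + 1) j)) =
        z (Sum.inr (Fin.natAdd (k + 1) (⟨0, by simp⟩ : Fin (c₁ :: rest).length))) := by
      intro j
      rcases fin_cons_cases c₁ rest j with rfl | ⟨i, rfl⟩
      · rfl
      · exact (huv i).2
    intro j j'
    exact ⟨(hu0 j).trans (hu0 j').symm, (hv0 j).trans (hv0 j').symm⟩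
  refine SymbData.det_monskyEvenS_eq_one_of_staged_constancy (agreeOffAux_dataK base (c₁ :: rest) (fun _ _ => false) pat)
    (δ₁ := 0) (δ₂ := 1) (by omega) (by omega) (by omega) ?_ ?_ ?_
  · -- stage one, direction u
    intro z hout hs1 hs2 i j hi hj
    simp only [if_true]
    obtain ⟨i', rfl⟩ := auxIdx i hi
    obtain ⟨j', rfl⟩ := auxIdx j hj
    exact (CORE z hout hs1 hs2 i' j').1
  · -- stage two, direction v
    intro z hout hs1 hs2 _ i j hi hj
    simp only [h10, if_false, if_true]
    obtain ⟨i', rfl⟩ := auxIdx i hi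
    obtain ⟨j', rfl⟩ := auxIdx j hj
    exact (CORE z hout hs1 hs2 i' j').2
  · -- stage three
    intro z hconst hz
    exact even_design_S3 base c₁ rest hm1 hmr σ hσ hσ1 dp hdp hd1 hF z hconst hz

/-- ★★ **Packaged form of the EVEN design criterion**: the design passes the general-`k` Heegner check and Monsky's even matrix of the base
`E_{2·P₀⋯P_k}` extended by the cells is invertible for every mutual pattern — a pattern-free Heegner recipe with `τ + 1` auxiliary primes for
the EVEN congruent-number bases. [cite: HeathBrown1994SelmerCongruentII, Appendix (Monsky), typescript p. 41 L20–L36] -/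
theorem even_design_recipe (hm1 : negNegOne c₁.1 = true)
    (hmr : ∀ i : Fin rest.length, negNegOne (rest.getD i.val (0, 0)).1 = false)
    (σ : Fin rest.length → Fin (k + 1) → ZMod 2) (hσ : ∀ i b, bz ((rest.getD i.val (0, 0)).2.testBit b.val) = σ i b)
    (hσ1 : ∀ b : Fin (k + 1), bz (c₁.2.testBit b.val) = bz (negNegOne (base.cls b)) + ∑ i, σ i b)
    (dp : Fin rest.length → ZMod 2) (hdp : ∀ i, bz (negTwo (rest.getD i.val (0, 0)).1) = dp i)
    (hd1 : bz (negTwo c₁.1) = ∑ i, dp i)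
    (hspan : ∀ a e : Fin rest.length → ZMod 2,
      (∀ lam mu : Fin (k + 1) → ZMod 2,
        (∀ b, (∑ b', bz (base.neg b b') * (lam b' + lam b)) + bz (negNegOne (base.cls b)) * lam b +
          bz (negTwo (base.cls b)) * lam b + bz (negTwo (base.cls b)) * mu b +
          bz (negNegOne (base.cls b)) * (∑ b', bz (negNegOne (base.cls b')) * mu b') = 0) →
        (∀ b, bz (negNegOne (base.cls b)) * lam b + (∑ b', bz (base.neg b b') * (mu b' + mu b)) +
          bz (negNegOne (base.cls b)) * (∑ b', bz (negNegOne (base.cls b')) * mu b') + bz (negTwo (base.cls b)) * mu b = 0) →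
        (∑ i, (a i * ((∑ b, σ i b * lam b) + (∑ b, bz (negNegOne (base.cls b)) * mu b) * ((∑ b, σ i b) + dp i)) +
          e i * (∑ b, σ i b * mu b))) = 0) →
      (∑ i, (dp i * a i + ((∑ b, σ i b) + dp i) * e i)) = 0 → (∀ i, a i = 0) ∧ (∀ i, e i = 0))
    (hF : ∀ (u v : Fin (k + 1) → ZMod 2) (U0 V0 : ZMod 2),
      (∀ b, (∑ b', bz (base.neg b b') * (u b' + u b)) +
        bz (negNegOne (base.cls b)) * (∑ b', bz (negNegOne (base.cls b')) * u b') +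
        bz (negTwo (base.cls b)) * u b + bz (negNegOne (base.cls b)) * v b = 0) →
      (∀ b, bz (negTwo (base.cls b)) * u b + (∑ b', bz (base.neg b b') * (v b' + v b)) +
        bz (negNegOne (base.cls b)) * v b + bz (negTwo (base.cls b)) * v b + bz (negNegOne (base.cls b)) * V0 = 0) →
      V0 = (∑ b', bz (negNegOne (base.cls b')) * u b') →
      (∀ i, (∑ b, σ i b * u b) + ((∑ b, σ i b) + dp i) * U0 = 0) →
      (∀ i, (∑ b, σ i b * v b) + (∑ b, σ i b) * V0 + dp i * (U0 + V0) = 0) →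
      u = 0 ∧ v = 0 ∧ U0 = 0 ∧ V0 = 0) :
    heegnerK base (c₁ :: rest) = true ∧ ∀ pat : ℕ → ℕ → Bool, (dataK base (c₁ :: rest) pat).monskyEvenS.det = 1 := by
  refine ⟨heegnerK_design base c₁ rest hm1 hmr ?_ ?_,
    fun pat => det_dataK_even_design_eq_one base c₁ rest hm1 hmr σ hσ hσ1 dp hdp hd1 hspan hF pat⟩
  · rw [hd1]; exact Finset.sum_congr rfl fun i _ => (hdp i).symm
  · intro b; rw [hσ1 b]; exact congrArg _ (Finset.sum_congr rfl fun i _ => (hσ i b).symm)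

end EvenDesignRecipe

end Summit.BirchSwinnertonDyer.BirchSwinnertonDyer.Theorems.SymbolicMonsky
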